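import Mathlib
import Summits.Ventures.PercRepro2.TwoHullMasterKeyedPendCover
import Summits.Ventures.PercRepro2.TwoHullMasterThetaCover

/-!
# Decorated paths, their theta graphs, and (MM) on all of them (blind cell PercRepro2, night-4 g40,
2026-08-29; proofs/NIGHT4-G40.md §15′)

The user-facing corollary of the keyed covers.  `Decorated l h E ends W` is the class of graphs
obtained from a graph with a classified keyed cover (`HasKeyedCover`; an injective path from `l` to
`h`, `hasKeyedCover_path`) by repeatedly gluing an arbitrary finite graph at a vertex other than `h`
(every tree with the marks anywhere among its vertices; g39's decorated paths);
`Theta l h E ends W` closes it under the parallel composition at the two marks (theta graphs of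
decorated paths, nested).  Iterating `keyedCover_pend` gives every decorated path a classified keyed
cover (`hasKeyedCover_of_decorated`, `decorated_path`), the keyed cover is mirrored on `l`, `cubeCover_glue2` composes
mirrored covers in parallel (`hasMirroredCover_of_theta`), and the block principle turns the cover into
(MM): **`twoHullMaster_decorated`**, **`twoHullMaster_theta`**, **`twoHullMaster_theta_h`** (a further
arbitrary graph glued at `h`), and row (SW) for every mark (`sw_decorated`, `sw_theta`).
-/

namespace Summit.Ventures.PercRepro2

namespace Blocks

open Hull LocRows Path2 Glue Glue2

open scoped Classical

variable {V : Type*}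

/-- **A classified keyed cover on `W`**: a keyed cover with finite index and coordinate types whose
blocks mirror the pair of `l`, whose classes lie in `W` and which classify every vertex of `W` other
than `h`. -/
def HasKeyedCover {E : Type} (ends : E → Sym2 V) (l h : V) (W : Set V) : Prop :=
  ∃ (β : Type) (_ : Fintype β) (ι : β → Type) (_ : ∀ b, Fintype (ι b))
    (pt : ∀ b, (ι b → Bool) → Config E) (sbit : ∀ b, (ι b → Bool) → Bool)
    (Before At After : β → Set V),
    KeyedCover ends l h pt sbit Before At After ∧ LMirror ends l pt ∧
    (∀ b, Before b ⊆ W ∧ At b ⊆ W ∧ After b ⊆ W) ∧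
    (∀ b, ∀ v ∈ W, v ≠ h → v ∈ Before b ∨ v ∈ At b ∨ v ∈ After b)

/-- **A mirrored cover**: a finite cube cover whose blocks mirror the pair of `l` — the hypothesis of
the parallel composition `cubeCover_glue2`. -/
def HasMirroredCover {E : Type} (ends : E → Sym2 V) (l h : V) : Prop :=
  ∃ (β : Type) (_ : Fintype β) (ι : β → Type) (_ : ∀ b, Fintype (ι b))
    (pt : ∀ b, (ι b → Bool) → Config E), CubeCover ends l h pt ∧ LMirror ends l pt

/-- **Decorated graphs**: the graphs obtained from a graph with a classified keyed cover on its
vertex set `W ∋ l, h` (an injective path from `l` to `h`, `decorated_path`; a graph with a kernel-checked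
keyed cover) by repeatedly gluing an arbitrary finite graph at a vertex other than `h`. -/
inductive Decorated (l h : V) : (E : Type) → (E → Sym2 V) → Set V → Prop
  | base {E : Type} {ends : E → Sym2 V} {W : Set V} (hk : HasKeyedCover ends l h W) (hl : l ∈ W)
      (hh : h ∈ W) (hlh : l ≠ h) : Decorated l h E ends W
  | pend {E₁ E₂ : Type} [Fintype E₂] {ends₁ : E₁ → Sym2 V} {ends₂ : E₂ → Sym2 V}
      {V₁ V₂ : Set V} {c : V} (hd : Decorated l h E₁ ends₁ V₁)
      (hg : IsGluing ends₁ ends₂ c V₁ V₂) (hc : c ≠ h) :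
      Decorated l h (E₁ ⊕ E₂) (Glue.glue ends₁ ends₂) (V₁ ∪ V₂)

/-- **Theta graphs of decorated paths**: decorated paths closed under the parallel composition at the
two marks. -/
inductive Theta (l h : V) : (E : Type) → (E → Sym2 V) → Set V → Prop
  | dec {E : Type} {ends : E → Sym2 V} {W : Set V} (hd : Decorated l h E ends W) :
      Theta l h E ends W
  | par {E₁ E₂ : Type} {ends₁ : E₁ → Sym2 V} {ends₂ : E₂ → Sym2 V} {V₁ V₂ : Set V}
      (ht₁ : Theta l h E₁ ends₁ V₁) (ht₂ : Theta l h E₂ ends₂ V₂)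
      (hg : IsGluing2 ends₁ ends₂ l h V₁ V₂) :
      Theta l h (E₁ ⊕ E₂) (glue2 ends₁ ends₂) (V₁ ∪ V₂)

/-- **The path cover is a classified keyed cover** on the vertices of the path. -/
theorem hasKeyedCover_path {k : ℕ} {p : Fin (k + 3) → V} (hp : Function.Injective p) :
    HasKeyedCover (pathEnds p) (p 0) (p (Fin.last (k + 2))) (Set.range p) := by
  refine ⟨_, inferInstance, pathι, pathιFintype, pathPt, sbit, pathBefore p, pathAt p,
    pathAfter p, keyedCover_path hp, lMirror_path, ?_, ?_⟩
  · rintro (i | u)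
    · refine ⟨?_, ?_, ?_⟩
      · rintro x ⟨v, rfl, -⟩; exact ⟨v, rfl⟩
      · rintro x ⟨v, rfl, -⟩; exact ⟨v, rfl⟩
      · rintro x ⟨v, rfl, -⟩; exact ⟨v, rfl⟩
    · refine ⟨?_, ?_, ?_⟩
      · rintro x ⟨v, rfl, -⟩; exact ⟨v, rfl⟩
      · rintro x ⟨v, rfl, -⟩; exact ⟨v, rfl⟩
      · exact Set.empty_subset _
  · rintro b v ⟨i, rfl⟩ hvh
    exact path_classified b i fun hi => hvh (congrArg p hi)

/-- **An injective path is a decorated graph.** -/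
theorem decorated_path {l h : V} {k : ℕ} (p : Fin (k + 3) → V) (hp : Function.Injective p)
    (h0 : p 0 = l) (hlast : p (Fin.last (k + 2)) = h) :
    Decorated l h (Fin (k + 2)) (pathEnds p) (Set.range p) := by
  subst h0 hlast
  refine Decorated.base (hasKeyedCover_path hp) ⟨0, rfl⟩ ⟨_, rfl⟩ fun heq => ?_
  have h1 := Fin.ext_iff.mp (hp heq)
  simp at h1

/-- The marks lie on a decorated graph and are distinct. -/
lemma Decorated.marks {l h : V} {E : Type} {ends : E → Sym2 V} {W : Set V}
    (hd : Decorated l h E ends W) : l ∈ W ∧ h ∈ W ∧ l ≠ h := by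
  induction hd with
  | base hk hl hh hlh => exact ⟨hl, hh, hlh⟩
  | pend hd hg hc ih => exact ⟨Or.inl ih.1, Or.inl ih.2.1, ih.2.2⟩

/-- The marks lie on a theta graph and are distinct. -/
lemma Theta.marks {l h : V} {E : Type} {ends : E → Sym2 V} {W : Set V}
    (ht : Theta l h E ends W) : l ∈ W ∧ h ∈ W ∧ l ≠ h := by
  induction ht with
  | dec hd => exact hd.marks
  | par ht₁ ht₂ hg ih₁ ih₂ => exact ⟨Or.inl ih₁.1, Or.inl ih₁.2.1, ih₁.2.2⟩

/-- **Every decorated graph has a classified keyed cover** — the tree rule, iterated: a pendant graph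
keeps a keyed cover keyed. -/
theorem hasKeyedCover_of_decorated {l h : V} {E : Type} {ends : E → Sym2 V} {W : Set V}
    (hd : Decorated l h E ends W) : HasKeyedCover ends l h W := by
  induction hd with
  | base hk hl hh hlh => exact hk
  | @pend E₁ E₂ _ ends₁ ends₂ V₁ V₂ c hd hg hc ih =>
    obtain ⟨β, hβ, ι, hι, pt, sbit, Before, At, After, hk, hm, hsub, hclass⟩ := ih
    have hmarks := hd.marks
    refine ⟨pendβ (β := β) E₂ At c, ?_, pendι ι At c, ?_, pendPt' (E₂ := E₂) pt sbit Before At c,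
      pendSbit (E₂ := E₂) sbit At c, pendBefore (E₂ := E₂) Before At c V₂,
      pendAt (E₂ := E₂) At c V₂, pendAfter (E₂ := E₂) Before At After c V₂,
      keyedCover_pend hg hmarks.1 hmarks.2.1 hc.symm hk (fun b => hclass b c hg.c_mem₁ hc) hsub,
      lMirror_pend hg hmarks.1 hk hm, ?_, ?_⟩
    · unfold pendβ; infer_instance
    · rintro (b | bc)
      · exact inferInstanceAs (Fintype (ι b.1 ⊕ E₂))
      · exact inferInstanceAs (Fintype (ι bc.1.1))
    · rintro (b | bc)
      · refine ⟨?_, ?_, ?_⟩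
        · show Before b.1 ∪ (if c ∈ Before b.1 then V₂ else ∅) ⊆ V₁ ∪ V₂
          exact Set.union_subset ((hsub b.1).1.trans Set.subset_union_left)
            (by split_ifs <;> simp)
        · show At b.1 ⊆ V₁ ∪ V₂
          exact (hsub b.1).2.1.trans Set.subset_union_left
        · show After b.1 ∪ (if c ∈ Before b.1 then ∅ else V₂) ⊆ V₁ ∪ V₂
          exact Set.union_subset ((hsub b.1).2.2.trans Set.subset_union_left)
            (by split_ifs <;> simp)
      · refine ⟨?_, ?_, ?_⟩
        · show Before bc.1.1 ⊆ V₁ ∪ V₂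
          exact (hsub bc.1.1).1.trans Set.subset_union_left
        · show At bc.1.1 ∪ V₂ ⊆ V₁ ∪ V₂
          exact Set.union_subset ((hsub bc.1.1).2.1.trans Set.subset_union_left)
            Set.subset_union_right
        · show After bc.1.1 ⊆ V₁ ∪ V₂
          exact (hsub bc.1.1).2.2.trans Set.subset_union_left
    · rintro (b | bc) v hv hvh
      · show v ∈ Before b.1 ∪ (if c ∈ Before b.1 then V₂ else ∅) ∨ v ∈ At b.1 ∨
          v ∈ After b.1 ∪ (if c ∈ Before b.1 then ∅ else V₂)
        rcases hv with hv | hv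
        · rcases hclass b.1 v hv hvh with h1 | h1 | h1
          · exact Or.inl (Or.inl h1)
          · exact Or.inr (Or.inl h1)
          · exact Or.inr (Or.inr (Or.inl h1))
        · by_cases hcb : c ∈ Before b.1
          · exact Or.inl (Or.inr (by simp [hcb, hv]))
          · exact Or.inr (Or.inr (Or.inr (by simp [hcb, hv])))
      · show v ∈ Before bc.1.1 ∨ v ∈ At bc.1.1 ∪ V₂ ∨ v ∈ After bc.1.1
        rcases hv with hv | hv
        · rcases hclass bc.1.1 v hv hvh with h1 | h1 | h1
          · exact Or.inl h1
          · exact Or.inr (Or.inl (Or.inl h1))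
          · exact Or.inr (Or.inr h1)
        · exact Or.inr (Or.inl (Or.inr hv))

/-- A classified keyed cover is a mirrored cover. -/
lemma hasMirroredCover_of_hasKeyedCover {l h : V} {E : Type} {ends : E → Sym2 V} {W : Set V}
    (hk : HasKeyedCover ends l h W) : HasMirroredCover ends l h := by
  obtain ⟨β, hβ, ι, hι, pt, sbit, Before, At, After, hk, hm, -, -⟩ := hk
  exact ⟨β, hβ, ι, hι, pt, hk.cover, hm⟩

/-- Mirrored covers compose in parallel at the two marks. -/
lemma hasMirroredCover_glue2 {l h : V} {E₁ E₂ : Type} {ends₁ : E₁ → Sym2 V}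
    {ends₂ : E₂ → Sym2 V} {V₁ V₂ : Set V} (hg : IsGluing2 ends₁ ends₂ l h V₁ V₂)
    (h₁ : HasMirroredCover ends₁ l h) (h₂ : HasMirroredCover ends₂ l h) :
    HasMirroredCover (glue2 ends₁ ends₂) l h := by
  obtain ⟨β₁, hβ₁, ι₁, hι₁, pt₁, hc₁, hm₁⟩ := h₁
  obtain ⟨β₂, hβ₂, ι₂, hι₂, pt₂, hc₂, hm₂⟩ := h₂
  exact ⟨β₁ × β₂, inferInstance, fun b => ι₁ b.1 ⊕ ι₂ b.2, fun b => inferInstance,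
    prodPt pt₁ pt₂, cubeCover_glue2 hg hc₁ hc₂ hm₁ hm₂, lMirror_prod hg hc₁ hc₂ hm₁ hm₂⟩

/-- **Every theta graph of decorated paths has a mirrored cover.** -/
theorem hasMirroredCover_of_theta {l h : V} {E : Type} {ends : E → Sym2 V} {W : Set V}
    (ht : Theta l h E ends W) : HasMirroredCover ends l h := by
  induction ht with
  | dec hd => exact hasMirroredCover_of_hasKeyedCover (hasKeyedCover_of_decorated hd)
  | par ht₁ ht₂ hg ih₁ ih₂ => exact hasMirroredCover_glue2 hg ih₁ ih₂

/-- (MM) from a mirrored cover, by the block principle. -/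
theorem twoHullMaster_of_hasMirroredCover {l h : V} {E : Type} [Fintype E] [DecidableEq E]
    {ends : E → Sym2 V} (hc : HasMirroredCover ends l h) : TwoHullMaster ends l h := by
  obtain ⟨β, hβ, ι, hι, pt, hc, -⟩ := hc
  exact twoHullMaster_of_cubeCover hc

/-- **(MM) on every decorated graph** — in particular on every tree with the marks anywhere among its
vertices (`decorated_path` + `Decorated.pend`). -/
theorem twoHullMaster_decorated {l h : V} {E : Type} [Fintype E] [DecidableEq E]
    {ends : E → Sym2 V} {W : Set V} (hd : Decorated l h E ends W) : TwoHullMaster ends l h :=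
  twoHullMaster_of_hasMirroredCover
    (hasMirroredCover_of_hasKeyedCover (hasKeyedCover_of_decorated hd))

/-- **(MM) on every theta graph of decorated paths** — g39's kernel class in one statement. -/
theorem twoHullMaster_theta {l h : V} {E : Type} [Fintype E] [DecidableEq E]
    {ends : E → Sym2 V} {W : Set V} (ht : Theta l h E ends W) : TwoHullMaster ends l h :=
  twoHullMaster_of_hasMirroredCover (hasMirroredCover_of_theta ht)

/-- **(MM) on a theta graph of decorated paths with a further arbitrary graph glued at `h`.** -/
theorem twoHullMaster_theta_h {l h : V} {E₁ E₂ : Type} [Fintype E₁] [DecidableEq E₁] [Fintype E₂]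
    [DecidableEq E₂] {ends₁ : E₁ → Sym2 V} {ends₂ : E₂ → Sym2 V} {V₁ V₂ : Set V}
    (ht : Theta l h E₁ ends₁ V₁) (hg : IsGluing ends₁ ends₂ h V₁ V₂) :
    TwoHullMaster (Glue.glue ends₁ ends₂) l h := by
  obtain ⟨β, hβ, ι, hι, pt, hc, -⟩ := hasMirroredCover_of_theta ht
  exact twoHullMaster_of_cubeCover (cubeCover_glue_h hg ht.marks.1 ht.marks.2.2 hc)

/-- Row (SW) on every decorated graph, for every mark. -/
theorem sw_decorated {l h : V} {E : Type} [Fintype E] [DecidableEq E] {ends : E → Sym2 V}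
    {W : Set V} (o : V) (hd : Decorated l h E ends W) : Sw ends l h o :=
  sw_of_twoHullMaster o (twoHullMaster_decorated hd)

/-- Row (SW) on every theta graph of decorated paths, for every mark. -/
theorem sw_theta {l h : V} {E : Type} [Fintype E] [DecidableEq E] {ends : E → Sym2 V}
    {W : Set V} (o : V) (ht : Theta l h E ends W) : Sw ends l h o :=
  sw_of_twoHullMaster o (twoHullMaster_theta ht)

end Blocks

end Summit.Ventures.PercRepro2
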